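import Mathlib
import Summits.NavierStokesRegularity.NavierStokesRegularity.Theorems.EulerZoomLiouvillePowerGaugeEulerLiouvilleSelfSimilarSourceExclusion
import Literature.Analysis.FluidPDE.HarmonicLiouvilleSublinear
import HarnessLib

/-!
# Rung C1 of the crux `EulerZoomLiouville.PowerGaugeEulerLiouville`: the vorticity zero set is invariant under the
# similarity flow, and BACKWARD CAPTURE by vorticity-free regions from a dense set kills the profile
# (route №10, item stmt-NavierStokesRegularity-19832; `--supports`)

Helper file (theorems only). Seat ns-typeII-p3 (cell ns-regularity-ideate §B, D-0081).  Third piece of KEEP-1/KEEP-2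
of the crux idea «hyperbolic-stagnation exclusion» (evidence #41 on the item), after `…SelfSimilarSourceExclusion`
(Cauchy formula, exclusion along a backward orbit) and `…SelfSimilarSourceBall` (vorticity vanishes on every adapted
source ball).  PROFILE LEVEL, classical (`IsSelfSimilarEulerProfile γ 0 V P`, `V` smooth, `‖DV‖ ≤ K`):

* `norm_fderiv_flow_apply_ge` — `DΦ_s(y)` is injective, quantitatively: `‖DΦ_s(y)v‖ ≥ e^{−(|γ|+K)|s|}‖v‖`
  (Grönwall on the variational equation);
* `curl_eq_zero_of_curl_flow_eq_zero` — **the zero set of `Ω = curl V` is invariant under the similarity flow**: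
  `Ω(Φ_s y) = 0` for one `s` ⇒ `Ω(y) = 0` (self-similar Cauchy formula `DΦ_s(y)Ω(y) = e^{(1+γ)s}Ω(Φ_s y)`, CIV
  (3.24), + injectivity) — so whatever is captured (forward OR backward) by a vorticity-free region is vorticity-free;
* `curl_eq_zero_of_dense_capture` — **GLOBAL FORM (KEEP-2, conditional)**: if a DENSE set of points `y` is captured,
  `Ω(Φ_{s_y} y) = 0` for some time `s_y` (e.g. their backward trajectories enter an adapted source ball of
  `…SelfSimilarSourceBall`), then `Ω ≡ 0`;
* `eq_const_of_dense_capture` — and if `DV → 0` at infinity (far field (3.8)), `V` is constant; with the CIV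
  normalisation `V(0) = 0`, `V ≡ 0` (`eq_zero_of_dense_capture`).

THE IDEA CARD'S CLAIM in kernel-checkable form: for an in-window classical profile whose stagnation set is FINITE and
HYPERBOLIC, every backward trajectory converges to a stagnation point (tree: `…SelfSimilarAlphaLimit`); those ending
at SOURCES form a dense (conull) set by the stable-manifold theorem (unstable manifolds of saddles are Lebesgue-null —
NOT in Mathlib, hence the density HYPOTHESIS here); sources carry adapted balls (`max Re λ < 3γ < 1+γ`); so the
hypotheses of `eq_zero_of_dense_capture` hold and the profile is trivial.

WHAT THIS IS NOT: not NS, not E, not rung C1 — the dynamical density hypothesis is exactly what remains (KEEP-2).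
[folklore; cf. ConstantinIgnatovaVicol2026Putative §3.4.1 (3.24), §3.5 proof of Thm 3.10 (propagation step)]
-/

noncomputable section

-- flat `Theorems/<Route><Decl>…` files of one crux share the namespace of the crux (tree convention)
set_option linter.dupNamespace false

open MeasureTheory Set Filter Topology Metric Function InnerProductSpace
open scoped RealInnerProductSpace NNReal ContDiff

namespace Summit.NavierStokesRegularity.NavierStokesRegularity.Theorems.PowerGaugeEulerLiouville.Kelvin

open Literature.Analysis Literature.Analysis.FluidPDE

variable {γ : ℝ} {V : EuclideanSpace ℝ (Fin 3) → EuclideanSpace ℝ (Fin 3)} {P : EuclideanSpace ℝ (Fin 3) → ℝ}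

/-! ### `DΦ_s(y)` is injective (Grönwall lower bound) -/

/-- **Quantitative injectivity of the flow gradient**: `‖DΦ_s(y) v‖² ≥ e^{−2(|γ|+K)|s|}‖v‖²` for all `s`
(`q(s) = ‖DΦ_s(y)v‖²` has `|q'| ≤ 2(|γ|+K) q` by the variational equation). [folklore] -/
theorem norm_sq_fderiv_flow_apply_ge (hV : ContDiff ℝ ∞ V) {K : ℝ} (hK : ∀ y, ‖fderiv ℝ V y‖ ≤ K)
    (y v : EuclideanSpace ℝ (Fin 3)) (s : ℝ) :
    Real.exp (-(2 * (|γ| + K)) * |s|) * ‖v‖ ^ 2 ≤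
      ‖fderiv ℝ (ODE.evolutionMap (fun _ : ℝ => selfSimilarTransport γ 0 V) 0 s) y v‖ ^ 2 := by
  set L : ℝ := |γ| + K with hL
  have hK0 : 0 ≤ K := (norm_nonneg _).trans (hK 0)
  have hL0 : 0 ≤ L := by positivity
  set X : ℝ → EuclideanSpace ℝ (Fin 3) := fun r =>
    fderiv ℝ (ODE.evolutionMap (fun _ : ℝ => selfSimilarTransport γ 0 V) 0 r) y v with hX
  have hX' : ∀ t, HasDerivAt X (γ • X t +
      fderiv ℝ V (ODE.evolutionMap (fun _ : ℝ => selfSimilarTransport γ 0 V) 0 t y) (X t)) t := by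
    intro t
    have h1 := (hasDerivAt_fderiv_flow (γ := γ) hV hK t y).clm_apply (hasDerivAt_const t v)
    simp only [map_zero, add_zero, ContinuousLinearMap.comp_apply, _root_.add_apply, _root_.smul_apply,
      ContinuousLinearMap.id_apply] at h1
    exact h1
  -- `q = ‖X‖²`, `q' = 2⟪A X, X⟫`, `|⟪A X, X⟫| ≤ L ‖X‖²`
  set q : ℝ → ℝ := fun r => ‖X r‖ ^ 2 with hq
  have hq' : ∀ t, HasDerivAt q (2 * ⟪γ • X t +
      fderiv ℝ V (ODE.evolutionMap (fun _ : ℝ => selfSimilarTransport γ 0 V) 0 t y) (X t), X t⟫) t := by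
    intro t
    have h := (hX' t).inner ℝ (hX' t)
    have e : (fun r => ⟪X r, X r⟫) = q := funext fun r => real_inner_self_eq_norm_sq (X r)
    rw [e] at h
    refine h.congr_deriv ?_
    rw [real_inner_comm (X t)]
    ring
  have hAbd : ∀ t, |⟪γ • X t +
      fderiv ℝ V (ODE.evolutionMap (fun _ : ℝ => selfSimilarTransport γ 0 V) 0 t y) (X t), X t⟫| ≤ L * q t := by
    intro t
    have h1 : ‖γ • X t + fderiv ℝ V (ODE.evolutionMap (fun _ : ℝ => selfSimilarTransport γ 0 V) 0 t y) (X t)‖ ≤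
        L * ‖X t‖ := by
      calc _ ≤ ‖γ • X t‖ + ‖fderiv ℝ V _ (X t)‖ := norm_add_le _ _
        _ ≤ |γ| * ‖X t‖ + K * ‖X t‖ := by
            rw [norm_smul, Real.norm_eq_abs]
            exact add_le_add le_rfl ((ContinuousLinearMap.le_opNorm _ _).trans
              (mul_le_mul_of_nonneg_right (hK _) (norm_nonneg _)))
        _ = L * ‖X t‖ := by rw [hL]; ring
    calc _ ≤ ‖γ • X t + fderiv ℝ V _ (X t)‖ * ‖X t‖ := abs_real_inner_le_norm _ _
      _ ≤ L * ‖X t‖ * ‖X t‖ := mul_le_mul_of_nonneg_right h1 (norm_nonneg _)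
      _ = L * q t := by rw [hq]; ring
  have hqc : Continuous q := continuous_iff_continuousAt.2 fun t => (hq' t).continuousAt
  have hq0 : q 0 = ‖v‖ ^ 2 := by
    have hΦ0 : ODE.evolutionMap (fun _ : ℝ => selfSimilarTransport γ 0 V) 0 0 = id :=
      funext (ODE.evolutionMap_self _ 0)
    simp only [hq, hX, hΦ0, fderiv_id, ContinuousLinearMap.coe_id', id_eq]
  -- case `s ≤ 0`: `F(r) = e^{−2Lr} q(r)` is non-increasing on `(−∞, 0]`
  -- case `s ≥ 0`: `F(r) = e^{2Lr} q(r)` is non-decreasing on `[0, ∞)`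
  rcases le_total s 0 with hs | hs
  · set F : ℝ → ℝ := fun r => Real.exp (-(2 * L) * r) * q r with hF
    have hF' : ∀ t, HasDerivAt F (Real.exp (-(2 * L) * t) * (-(2 * L)) * q t +
        Real.exp (-(2 * L) * t) * (2 * ⟪γ • X t +
          fderiv ℝ V (ODE.evolutionMap (fun _ : ℝ => selfSimilarTransport γ 0 V) 0 t y) (X t), X t⟫)) t := by
      intro t
      have hexp : HasDerivAt (fun r => Real.exp (-(2 * L) * r)) (Real.exp (-(2 * L) * t) * (-(2 * L))) t := by
        simpa using ((hasDerivAt_id t).const_mul (-(2 * L))).exp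
      exact hexp.mul (hq' t)
    have hanti : AntitoneOn F (Iic 0) := by
      have hFc : Continuous F := continuous_iff_continuousAt.2 fun t => (hF' t).continuousAt
      refine antitoneOn_of_hasDerivWithinAt_nonpos (convex_Iic 0) hFc.continuousOn
        (fun t _ => (hF' t).hasDerivWithinAt) fun t _ => ?_
      have h1 := (abs_le.1 (hAbd t)).2
      have hpos : 0 < Real.exp (-(2 * L) * t) := Real.exp_pos _
      nlinarith
    have h1 : F 0 ≤ F s := hanti (mem_Iic.2 hs) (mem_Iic.2 le_rfl) hs
    simp only [hF, mul_zero, Real.exp_zero, one_mul] at h1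
    rw [hq0] at h1
    rw [abs_of_nonpos hs]
    have hexp : Real.exp (-(2 * (|γ| + K)) * -s) * Real.exp (-(2 * L) * s) = 1 := by
      rw [← Real.exp_add, hL]; ring_nf; simp
    calc Real.exp (-(2 * (|γ| + K)) * -s) * ‖v‖ ^ 2
        ≤ Real.exp (-(2 * (|γ| + K)) * -s) * (Real.exp (-(2 * L) * s) * q s) :=
          mul_le_mul_of_nonneg_left h1 (Real.exp_pos _).le
      _ = q s := by rw [← mul_assoc, hexp, one_mul]
  · set F : ℝ → ℝ := fun r => Real.exp ((2 * L) * r) * q r with hF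
    have hF' : ∀ t, HasDerivAt F (Real.exp ((2 * L) * t) * (2 * L) * q t +
        Real.exp ((2 * L) * t) * (2 * ⟪γ • X t +
          fderiv ℝ V (ODE.evolutionMap (fun _ : ℝ => selfSimilarTransport γ 0 V) 0 t y) (X t), X t⟫)) t := by
      intro t
      have hexp : HasDerivAt (fun r => Real.exp ((2 * L) * r)) (Real.exp ((2 * L) * t) * (2 * L)) t := by
        simpa using ((hasDerivAt_id t).const_mul (2 * L)).exp
      exact hexp.mul (hq' t)
    have hmono : MonotoneOn F (Ici 0) := by
      have hFc : Continuous F := continuous_iff_continuousAt.2 fun t => (hF' t).continuousAt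
      refine monotoneOn_of_hasDerivWithinAt_nonneg (convex_Ici 0) hFc.continuousOn
        (fun t _ => (hF' t).hasDerivWithinAt) fun t _ => ?_
      have h1 := (abs_le.1 (hAbd t)).1
      have hpos : 0 < Real.exp ((2 * L) * t) := Real.exp_pos _
      nlinarith
    have h1 : F 0 ≤ F s := hmono (mem_Ici.2 le_rfl) (mem_Ici.2 hs) hs
    simp only [hF, mul_zero, Real.exp_zero, one_mul] at h1
    rw [hq0] at h1
    rw [abs_of_nonneg hs]
    have hexp : Real.exp (-(2 * (|γ| + K)) * s) * Real.exp ((2 * L) * s) = 1 := by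
      rw [← Real.exp_add, hL]; ring_nf; simp
    calc Real.exp (-(2 * (|γ| + K)) * s) * ‖v‖ ^ 2
        ≤ Real.exp (-(2 * (|γ| + K)) * s) * (Real.exp ((2 * L) * s) * q s) :=
          mul_le_mul_of_nonneg_left h1 (Real.exp_pos _).le
      _ = q s := by rw [← mul_assoc, hexp, one_mul]

/-! ### The vorticity zero set is flow-invariant -/

/-- **The zero set of the vorticity profile is invariant under the similarity flow**: if `curl V (Φ_s y) = 0` for
some `s ∈ ℝ`, then `curl V (y) = 0` (Cauchy formula `DΦ_s(y)Ω(y) = e^{(1+γ)s}Ω(Φ_s y)` and injectivity of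
`DΦ_s(y)`).  [cite: ConstantinIgnatovaVicol2026Putative, §3.4.1 eq. (3.24)] -/
theorem curl_eq_zero_of_curl_flow_eq_zero (hV : ContDiff ℝ ∞ V) {K : ℝ} (hK : ∀ y, ‖fderiv ℝ V y‖ ≤ K)
    (hprof : IsSelfSimilarEulerProfile γ 0 V P) {y : EuclideanSpace ℝ (Fin 3)} {s : ℝ}
    (hs : curl V (ODE.evolutionMap (fun _ : ℝ => selfSimilarTransport γ 0 V) 0 s y) = 0) :
    curl V y = 0 := by
  have hc := cauchy_formula_flow hV hK hprof y s
  rw [hs, smul_zero] at hc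
  have hlow := norm_sq_fderiv_flow_apply_ge (γ := γ) hV hK y (curl V y) s
  rw [hc, norm_zero] at hlow
  have h1 : Real.exp (-(2 * (|γ| + K)) * |s|) * ‖curl V y‖ ^ 2 ≤ 0 := by simpa using hlow
  have hpos : 0 < Real.exp (-(2 * (|γ| + K)) * |s|) := Real.exp_pos _
  have h2 : ‖curl V y‖ ^ 2 ≤ 0 := by
    by_contra hcon
    push Not at hcon
    have := mul_pos hpos hcon
    linarith
  have h3 : ‖curl V y‖ = 0 := by nlinarith [norm_nonneg (curl V y)]
  exact norm_eq_zero.1 h3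

/-! ### Global form: dense capture kills the vorticity, then the profile -/

/-- **Dense capture ⇒ irrotational**: if a dense set of points `y` are CAPTURED by the vorticity-free set, i.e.
`curl V (Φ_{s} y) = 0` for some time `s = s(y)` (for instance because their backward trajectories enter an adapted
source ball, `…SelfSimilarSourceBall.curl_eq_zero_on_adaptedSourceBall`), then `curl V ≡ 0`.
[folklore; cf. ConstantinIgnatovaVicol2026Putative §3.5 proof of Thm 3.10 (propagation step)] -/
theorem curl_eq_zero_of_dense_capture (hV : ContDiff ℝ ∞ V) {K : ℝ} (hK : ∀ y, ‖fderiv ℝ V y‖ ≤ K)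
    (hprof : IsSelfSimilarEulerProfile γ 0 V P) {D : Set (EuclideanSpace ℝ (Fin 3))} (hD : Dense D)
    (hcap : ∀ y ∈ D, ∃ s : ℝ, curl V (ODE.evolutionMap (fun _ : ℝ => selfSimilarTransport γ 0 V) 0 s y) = 0) :
    ∀ y, curl V y = 0 := by
  have hV2 : ContDiff ℝ 2 V := hV.of_le (by norm_cast)
  have hcont : Continuous (curl V) := (differentiable_curl_of_contDiff hV2).continuous
  have hzero : ∀ y ∈ D, curl V y = 0 := by
    intro y hy
    obtain ⟨s, hs⟩ := hcap y hy
    exact curl_eq_zero_of_curl_flow_eq_zero hV hK hprof hs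
  intro y
  have hclosed : IsClosed {z : EuclideanSpace ℝ (Fin 3) | curl V z = 0} := isClosed_eq hcont continuous_const
  have hsub : closure D ⊆ {z | curl V z = 0} := hclosed.closure_subset_iff.2 hzero
  exact hsub (hD.closure_eq ▸ mem_univ y)

/-- **Dense capture + far field ⇒ the profile is constant**: under the hypotheses of
`curl_eq_zero_of_dense_capture` and `DV → 0` at infinity, `V` is constant (harmonic Liouville for the curl- and
divergence-free field `V`, tree `eq_of_curl_eq_zero_of_isDivFree_of_fderiv_tendsto_zero`).
[folklore; cf. ConstantinIgnatovaVicol2026Putative §3.5 Thm 3.10] -/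
theorem eq_const_of_dense_capture (hV : ContDiff ℝ ∞ V) {K : ℝ} (hK : ∀ y, ‖fderiv ℝ V y‖ ≤ K)
    (hprof : IsSelfSimilarEulerProfile γ 0 V P) {D : Set (EuclideanSpace ℝ (Fin 3))} (hD : Dense D)
    (hcap : ∀ y ∈ D, ∃ s : ℝ, curl V (ODE.evolutionMap (fun _ : ℝ => selfSimilarTransport γ 0 V) 0 s y) = 0)
    (hfar : Tendsto (fun y => ‖fderiv ℝ V y‖) (cocompact (EuclideanSpace ℝ (Fin 3))) (𝓝 0)) :
    ∀ y, V y = V 0 :=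
  fun y => eq_of_curl_eq_zero_of_isDivFree_of_fderiv_tendsto_zero (hV.of_le (by norm_cast))
    (curl_eq_zero_of_dense_capture hV hK hprof hD hcap) hprof.divFree hfar y 0

/-- **Dense capture + far field + CIV normalisation `V(0) = 0` ⇒ `V ≡ 0`.**  This is the idea card's claim with
its dynamical input isolated as the hypothesis `hcap` (for a finite hyperbolic stagnation set in the window, the
stable-manifold theorem supplies it on a conull, hence dense, set). [folklore] -/
theorem eq_zero_of_dense_capture (hV : ContDiff ℝ ∞ V) {K : ℝ} (hK : ∀ y, ‖fderiv ℝ V y‖ ≤ K)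
    (hprof : IsSelfSimilarEulerProfile γ 0 V P) {D : Set (EuclideanSpace ℝ (Fin 3))} (hD : Dense D)
    (hcap : ∀ y ∈ D, ∃ s : ℝ, curl V (ODE.evolutionMap (fun _ : ℝ => selfSimilarTransport γ 0 V) 0 s y) = 0)
    (hfar : Tendsto (fun y => ‖fderiv ℝ V y‖) (cocompact (EuclideanSpace ℝ (Fin 3))) (𝓝 0)) (h0 : V 0 = 0) :
    V = 0 := by
  funext y
  rw [eq_const_of_dense_capture hV hK hprof hD hcap hfar y, h0]
  rfl

end Summit.NavierStokesRegularity.NavierStokesRegularity.Theorems.PowerGaugeEulerLiouville.Kelvin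

end
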